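import Literature.Computability.Cryptography.ExplicitKWiseHashFamily
import Literature.Computability.Complexity.GF2StringArith
import HarnessLib

/-!
# The explicit `k`-wise independent hash family as bit-string arithmetic (value level of its evaluation machine)

Sequel of `ExplicitKWiseHashFamily.lean` (the Wegman–Carter family over `BinField j = 𝔽₂[X]/(modulus j)`,
`modulus j = X^{2·3^j} + X^{3^j} + 1`, and its keyed language `hashLang`). Wegman–Carter note that a member of the
family is evaluated by `k` multiplications and additions in the field; this file writes that evaluation as pure
functions on bit strings — with the tree's `𝔽₂[X]` string arithmetic `GF2Str.polyOfBits / xorStr / clmul / pmodStr`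
(`Complexity/GF2StringArith.lean`), the layer the `FP` bricks `HardLangM.xorF / clmulF / pmodF / fmulOpF`
(`Complexity/HardLangMachine.lean`) compute for ANY monic modulus string — and proves it correct against the field:

* `fieldBits j z` — the `dim j` power-basis bits of `z` (`polyOfBits_fieldBits_mk`: the bits of the class of `p`
  spell `p mod modulus j`; `mk_polyOfBits_fieldBits`; `fieldBits_eq_of_mk_eq`); `modStr j` — the `dim j + 1` bits
  of the modulus (`polyOfBits_modStr`, `modStr_top`, `getD_modStr`: bits `0`, `3^j`, `2·3^j` set);
* `xorStr_fieldBits` (addition), `fmulStr j` / `fmulStr_fieldBits` (multiplication = carry-less product reduced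
  modulo `modStr j`), `fieldBits_zero`;
* `hornerStr j z cs` — Horner evaluation `c₀ + z(c₁ + z(⋯))` on bit strings, `hornerStr_fieldBits`;
  `foldr_horner_eq_sum` (`= Σ_t c_t z^t`, the value of the key polynomial, tree `PolynomialHash.polyKey_eval`);
* `padStr d u = (u ++ 1 ++ 0^d) ↾ d` with `padStr_eq_ofFn` (`= padBits`) and `fieldBits_embed`;
  `fieldBits_keySplit_fst`: coefficient `t` of the decoded key is the key block `[dim j · t, dim j · (t+1))`;
  `getD_fieldBits_zero` (the output bit is bit `0`);
* **`hashBitStr j k keyL u`** (blocks of the key string, Horner at the padded point, bit `0`) with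
  **`hashBitStr_ofFn`**: `hashBitStr j k (ofFn key) u = decide (u ∈ family j k N key)` whenever `k·dim j ≤ N`;
  `stdHashBitStr` / `stdHashBitStr_ofFn` for the standard parameters;
* **`hashLangDecide w`** — decode `w = ⟨⟨1ᵏ, key⟩, u⟩`, re-encode and compare, find `m` with `|key| = 6(k+m+1)²`,
  evaluate — and **`hashLangDecide_eq : hashLangDecide w = decide (w ∈ hashLang)`**: the exact Boolean function
  a polynomial-time machine for `hashLang` has to compute (the machine itself is not written here).

Sources: M. N. Wegman, J. L. Carter, JCSS 22 (1981) §3 (evaluation of the polynomial families)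
[cite: WegmanCarter1981, §3]; R. J. McEliece, The Theory of Information and Coding (2002), Ch. 9 §9.1 (binary
polynomial arithmetic on coefficient vectors) [cite: Mceliece2002, Ch. 9 §9.1].
-/

noncomputable section

namespace Literature.Computability.Cryptography.ExplicitKWiseHash

open Finset Polynomial Literature.Computability.QuantumComplexity Literature.Computability.Complexity
  Literature.Computability.Complexity.GF2Str Literature.Computability.Cryptography.PolynomialHash

variable (j : ℕ)

/-! ### Field elements and the modulus as bit strings -/

/-- The `dim j` power-basis bits of a field element, listed. [cite: Mceliece2002, Ch. 9 §9.1] -/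
def fieldBits (z : BinField j) : List Bool := List.ofFn (bitsEquiv j z)

/-- `fieldBits` has length `dim j`. [cite: Mceliece2002, Ch. 9 §9.1] -/
@[simp] theorem length_fieldBits (z : BinField j) : (fieldBits j z).length = dim j := by
  simp [fieldBits]

/-- Entry `i` of `fieldBits j z` is coordinate `i`. [cite: Mceliece2002, Ch. 9 §9.1] -/
theorem getElem_fieldBits (z : BinField j) (i : ℕ) (h : i < (fieldBits j z).length) :
    (fieldBits j z)[i] = bitsEquiv j z ⟨i, by simpa using h⟩ := by
  simp [fieldBits]

/-- `fieldBits` is injective. [cite: Mceliece2002, Ch. 9 §9.1] -/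
theorem fieldBits_injective : Function.Injective (fieldBits j) := fun _ _ h =>
  (bitsEquiv j).injective (List.ofFn_injective h)

/-- **The bits of the class of `p` spell `p mod (modulus j)`.** [cite: Mceliece2002, Ch. 9 §9.1] -/
theorem polyOfBits_fieldBits_mk (p : (ZMod 2)[X]) :
    polyOfBits (fieldBits j (AdjoinRoot.mk (modulus j) p)) = p %ₘ modulus j := by
  ext i
  rw [coeff_polyOfBits]
  by_cases hi : i < dim j
  · rw [fieldBits, List.getD_eq_getElem _ _ (by simpa using hi), List.getElem_ofFn, bitsEquiv_apply,
      coordEquiv_mk]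
    exact bitZ_zBit _
  · rw [List.getD_eq_default _ _ (by simpa using hi)]
    have hdeg : (p %ₘ modulus j).degree < ((dim j : ℕ) : WithBot ℕ) := by
      rw [dim, ← degree_eq_natDegree (monic_modulus j).ne_zero]
      exact degree_modByMonic_lt p (monic_modulus j)
    rw [coeff_eq_zero_of_degree_lt (lt_of_lt_of_le hdeg (by exact_mod_cast not_lt.1 hi))]
    rfl

/-- The bits of `z` spell a representative of `z`. [cite: Mceliece2002, Ch. 9 §9.1] -/
theorem mk_polyOfBits_fieldBits (z : BinField j) :
    AdjoinRoot.mk (modulus j) (polyOfBits (fieldBits j z)) = z := by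
  obtain ⟨p, rfl⟩ := AdjoinRoot.mk_surjective z
  rw [polyOfBits_fieldBits_mk, AdjoinRoot.mk_eq_mk]
  have := modByMonic_add_div p (modulus j)
  exact ⟨-(p /ₘ modulus j), by linear_combination this⟩

/-- The bits spell the CANONICAL representative. [cite: Mceliece2002, Ch. 9 §9.1] -/
theorem polyOfBits_fieldBits (z : BinField j) :
    polyOfBits (fieldBits j z) = polyOfBits (fieldBits j z) %ₘ modulus j := by
  conv_lhs => rw [← mk_polyOfBits_fieldBits j z, polyOfBits_fieldBits_mk]

/-- **Bits are determined by any representative**: if `mk p = z`, a string of `dim j` bits spelling `p mod modulus j`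
is `fieldBits j z`. [cite: Mceliece2002, Ch. 9 §9.1] -/
theorem fieldBits_eq_of_mk_eq {z : BinField j} {p : (ZMod 2)[X]} (h : AdjoinRoot.mk (modulus j) p = z)
    {l : List Bool} (hl : l.length = dim j) (hp : polyOfBits l = p %ₘ modulus j) : fieldBits j z = l := by
  subst h
  exact eq_of_polyOfBits_eq (by rw [length_fieldBits, hl]) (by rw [polyOfBits_fieldBits_mk, hp])

/-- The bits of `0` are `0^{dim j}`. [cite: Mceliece2002, Ch. 9 §9.1] -/
theorem fieldBits_zero : fieldBits j 0 = List.replicate (dim j) false :=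
  fieldBits_eq_of_mk_eq j (p := 0) (map_zero _) (by simp) (by rw [polyOfBits_replicate, zero_modByMonic])

/-- The `dim j + 1` bits of the modulus. [cite: Mceliece2002, Ch. 9 §9.1] -/
def modStr : List Bool := List.ofFn fun i : Fin (dim j + 1) => zBit ((modulus j).coeff i)

/-- The modulus string spells `modulus j`. [cite: Mceliece2002, Ch. 9 §9.1] -/
theorem polyOfBits_modStr : polyOfBits (modStr j) = modulus j := by
  ext i
  rw [coeff_polyOfBits]
  by_cases hi : i < dim j + 1
  · rw [modStr, List.getD_eq_getElem _ _ (by simpa using hi), List.getElem_ofFn]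
    exact bitZ_zBit _
  · rw [List.getD_eq_default _ _ (by simpa [modStr] using hi)]
    rw [coeff_eq_zero_of_natDegree_lt (by rw [← dim]; omega)]
    rfl

/-- The modulus string has `dim j + 1` bits, the top one set. [cite: Mceliece2002, Ch. 9 §9.1] -/
theorem modStr_top : (modStr j).length = dim j + 1 ∧ (modStr j).getD (dim j) false = true := by
  refine ⟨by simp [modStr], ?_⟩
  have := congrArg (fun q => zBit (q.coeff (dim j))) (polyOfBits_modStr j)
  simp only [coeff_polyOfBits, zBit_bitZ] at this
  rw [this]
  have h := monic_modulus j
  rw [Monic, leadingCoeff] at h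
  rw [dim, h]; rfl

/-- Bit `i` of the modulus string is the coefficient of `X^i` in `modulus j`. [cite: Mceliece2002, Ch. 9 §9.1] -/
theorem getD_modStr (i : ℕ) : (modStr j).getD i false = zBit ((modulus j).coeff i) := by
  have := congrArg (fun q => zBit (q.coeff i)) (polyOfBits_modStr j)
  simpa only [coeff_polyOfBits, zBit_bitZ] using this

/-- **The coefficients of the modulus explicitly**: `1` exactly at `0`, `3^j`, `2·3^j`.
[cite: BlakeEtAl1993, Ch. 3 Exercise 3.2] -/
theorem coeff_modulus (i : ℕ) :
    (modulus j).coeff i = if i = 2 * 3 ^ j ∨ i = 3 ^ j ∨ i = 0 then 1 else 0 := by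
  have h3 : 0 < 3 ^ j := by positivity
  rw [modulus_eq]
  simp only [coeff_add, coeff_X_pow, coeff_one]
  by_cases h2 : i = 2 * 3 ^ j
  · have h1 : ¬ i = 3 ^ j := by omega
    have h0 : ¬ i = 0 := by omega
    rw [if_pos h2, if_neg h1, if_neg h0, if_pos (Or.inl h2)]; ring
  · by_cases h1 : i = 3 ^ j
    · have h0 : ¬ i = 0 := by omega
      rw [if_neg h2, if_pos h1, if_neg h0, if_pos (Or.inr (Or.inl h1))]; ring
    · by_cases h0 : i = 0
      · rw [if_neg h2, if_neg h1, if_pos h0, if_pos (Or.inr (Or.inr h0))]; ring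
      · rw [if_neg h2, if_neg h1, if_neg h0, if_neg (by push Not; exact ⟨h2, h1, h0⟩)]; ring

/-! ### Field operations on bits -/

/-- **Field addition on bits.** [cite: Mceliece2002, Ch. 9 §9.1] -/
theorem xorStr_fieldBits (u v : BinField j) : xorStr (fieldBits j u) (fieldBits j v) = fieldBits j (u + v) := by
  symm
  refine fieldBits_eq_of_mk_eq j (p := polyOfBits (fieldBits j u) + polyOfBits (fieldBits j v)) ?_ ?_ ?_
  · rw [map_add, mk_polyOfBits_fieldBits, mk_polyOfBits_fieldBits]
  · rw [length_xorStr, length_fieldBits, length_fieldBits, max_self]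
  · rw [polyOfBits_xorStr, add_modByMonic, ← polyOfBits_fieldBits, ← polyOfBits_fieldBits]

/-- **Field multiplication on bits**: carry-less product, then remainder modulo `modStr j`.
[cite: Mceliece2002, Ch. 9 §9.1] -/
def fmulStr (a b : List Bool) : List Bool := pmodStr (dim j) (modStr j) (clmul a b)

/-- `fmulStr` multiplies. [cite: Mceliece2002, Ch. 9 §9.1] -/
theorem fmulStr_fieldBits (u v : BinField j) : fmulStr j (fieldBits j u) (fieldBits j v) = fieldBits j (u * v) := by
  symm
  refine fieldBits_eq_of_mk_eq j (p := polyOfBits (fieldBits j u) * polyOfBits (fieldBits j v)) ?_ ?_ ?_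
  · rw [map_mul, mk_polyOfBits_fieldBits, mk_polyOfBits_fieldBits]
  · exact length_pmodStr _ _ (modStr_top j).1 _
  · rw [fmulStr, polyOfBits_pmodStr _ _ (modStr_top j).1 (modStr_top j).2, polyOfBits_clmul, polyOfBits_modStr]

/-! ### Horner evaluation -/

/-- **Horner evaluation on bits**: `hornerStr j z [c₀, …, c_{k−1}] = c₀ + z·(c₁ + z·(⋯ (c_{k−1} + z·0)))`.
[cite: WegmanCarter1981, §3] -/
def hornerStr (z : List Bool) (cs : List (List Bool)) : List Bool :=
  cs.foldr (fun c acc => xorStr c (fmulStr j acc z)) (List.replicate (dim j) false)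

/-- `hornerStr` evaluates. [cite: WegmanCarter1981, §3] -/
theorem hornerStr_fieldBits (z : BinField j) (cs : List (BinField j)) :
    hornerStr j (fieldBits j z) (cs.map (fieldBits j)) = fieldBits j (cs.foldr (fun c acc => c + acc * z) 0) := by
  induction cs with
  | nil => simp [hornerStr, fieldBits_zero]
  | cons c cs ih =>
    rw [List.map_cons, List.foldr_cons]
    change xorStr (fieldBits j c) (fmulStr j (hornerStr j (fieldBits j z) (cs.map (fieldBits j))) (fieldBits j z)) = _
    rw [ih, fmulStr_fieldBits, xorStr_fieldBits]

/-- The Horner fold of a coefficient vector is the value `Σ_t c_t z^t`. [cite: WegmanCarter1981, §3] -/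
theorem foldr_horner_eq_sum {F : Type*} [CommSemiring F] (z : F) :
    ∀ {k : ℕ} (c : Fin k → F), (List.ofFn c).foldr (fun a acc => a + acc * z) 0 = ∑ t : Fin k, c t * z ^ (t : ℕ)
  | 0, c => by simp
  | k + 1, c => by
    rw [List.ofFn_succ, List.foldr_cons, foldr_horner_eq_sum z (fun i => c i.succ), Fin.sum_univ_succ]
    simp only [Fin.val_zero, pow_zero, mul_one, Fin.val_succ, pow_succ]
    rw [Finset.sum_mul]
    congr 1
    exact Finset.sum_congr rfl fun i _ => by ring

/-! ### The padded point, the key blocks, the output bit -/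

/-- The padded point on strings: `(u ++ 1 ++ 0^d) ↾ d`. [cite: WegmanCarter1981, §3] -/
def padStr (d : ℕ) (u : List Bool) : List Bool := (u ++ true :: List.replicate d false).take d

/-- `padStr` is `padBits`, listed. [cite: WegmanCarter1981, §3] -/
theorem padStr_eq_ofFn (d : ℕ) (u : List Bool) : padStr d u = List.ofFn (padBits d u) := by
  apply List.ext_getElem
  · simp only [padStr, List.length_take, List.length_append, List.length_cons, List.length_replicate,
      List.length_ofFn]
    omega
  · intro i h1 h2
    simp only [List.length_ofFn] at h2
    rw [List.getElem_ofFn]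
    simp only [padStr, List.getElem_take, padBits]
    by_cases hi : i < u.length
    · rw [List.getElem_append_left hi, dif_pos hi]
    · rw [List.getElem_append_right (by omega), dif_neg hi]
      by_cases he : i = u.length
      · simp [he]
      · rw [List.getElem_cons]
        simp [show i - u.length ≠ 0 by omega, he]

/-- `padStr d u` has length `d`. [cite: WegmanCarter1981, §3] -/
@[simp] theorem length_padStr (d : ℕ) (u : List Bool) : (padStr d u).length = d := by
  rw [padStr_eq_ofFn, List.length_ofFn]

/-- **The bits of the embedded string are the padded string.** [cite: WegmanCarter1981, §3] -/
theorem fieldBits_embed (u : List Bool) : fieldBits j (embed j u) = padStr (dim j) u := by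
  rw [fieldBits, embed, Equiv.apply_symm_apply, padStr_eq_ofFn]

/-- **The bits of coefficient `t` of the decoded key are the key block `[dim j · t, dim j · (t + 1))`.**
[cite: WegmanCarter1981, §3] -/
theorem fieldBits_keySplit_fst {k N : ℕ} (h : k * dim j ≤ N) (key : Fin N → Bool) (t : Fin k) :
    fieldBits j ((keySplit j k N h key).1 t) = ((List.ofFn key).drop (dim j * t)).take (dim j) := by
  have ht : dim j * (t : ℕ) + dim j ≤ N := by
    have h1 := Nat.mul_le_mul_left (dim j) (Nat.succ_le_of_lt t.2)
    rw [Nat.mul_succ] at h1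
    have h2 : dim j * k = k * dim j := Nat.mul_comm _ _
    omega
  apply List.ext_getElem
  · simp only [length_fieldBits, List.length_take, List.length_drop, List.length_ofFn]
    omega
  · intro i h1 h2
    rw [length_fieldBits] at h1
    rw [getElem_fieldBits, bitsEquiv_keySplit_fst, List.getElem_take, List.getElem_drop, List.getElem_ofFn]
    congr 1
    exact Fin.ext (show i + dim j * (t : ℕ) = dim j * (t : ℕ) + i by omega)

/-- **The output bit is bit `0` of the bit string.** [cite: WegmanCarter1981, §3] -/
theorem getD_fieldBits_zero (z : BinField j) : (fieldBits j z).getD 0 false = outBit j z := by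
  rw [fieldBits, List.getD_eq_getElem _ _ (by simp [dim_pos]), List.getElem_ofFn]
  rfl

/-! ### The hash bit on strings -/

/-- **The hash bit on strings**: cut the key string into `k` blocks of `dim j` bits (the coefficients), evaluate by
Horner at the padded point, return bit `0`. [cite: WegmanCarter1981, §3] -/
def hashBitStr (j k : ℕ) (keyL u : List Bool) : Bool :=
  (hornerStr j (padStr (dim j) u) ((List.range k).map fun t => (keyL.drop (dim j * t)).take (dim j))).getD 0 false

/-- `(range k).map g` as an `ofFn`. [folklore] -/
private theorem map_range_eq_ofFn {α : Type*} (k : ℕ) (g : ℕ → α) :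
    (List.range k).map g = List.ofFn fun t : Fin k => g t := by
  apply List.ext_getElem
  · simp
  · intro i h1 h2
    simp [List.getElem_ofFn]

/-- The key polynomial evaluates as `Σ_t c_t u^t` (the tree's `PolynomialHash.polyKey_eval`, over a commutative
ring). [cite: WegmanCarter1981, §3] -/
private theorem polyKey_eval' {R : Type*} [CommRing R] (k : ℕ) (c : Fin k → R) (u : R) :
    (((degreeLTEquiv R k).symm c : degreeLT R k) : R[X]).eval u = ∑ t : Fin k, c t * u ^ (t : ℕ) := by
  set p := (degreeLTEquiv R k).symm c with hp
  have h := eval_eq_sum_degreeLTEquiv (R := R) p.2 u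
  have hc : degreeLTEquiv R k ⟨(p : R[X]), p.2⟩ = c := by
    rw [Subtype.coe_eta, hp, LinearEquiv.apply_symm_apply]
  rw [hc] at h
  exact h

open scoped Classical in
/-- **The hash bit on strings is membership in the family**: for a key of `N ≥ k·dim j` bits,
`hashBitStr j k (ofFn key) u = [u ∈ family j k N key]`. [cite: WegmanCarter1981, §3] -/
theorem hashBitStr_ofFn (j k N : ℕ) (h : k * dim j ≤ N) (key : Fin N → Bool) (u : List Bool) :
    hashBitStr j k (List.ofFn key) u = decide (u ∈ family j k N key) := by
  simp only [family, dif_pos h, Set.mem_setOf_eq, Bool.decide_eq_true]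
  rw [polyKey_eval' k (keySplit j k N h key).1 (embed j u), ← foldr_horner_eq_sum (embed j u) (keySplit j k N h key).1,
    ← getD_fieldBits_zero, ← hornerStr_fieldBits j (embed j u) (List.ofFn (keySplit j k N h key).1), fieldBits_embed,
    List.map_ofFn, hashBitStr, map_range_eq_ofFn]
  have hcoef : (fun t : Fin k => ((List.ofFn key).drop (dim j * (t : ℕ))).take (dim j)) =
      fieldBits j ∘ (keySplit j k N h key).1 := by
    funext t
    rw [Function.comp_apply, fieldBits_keySplit_fst]
  rw [hcoef]

/-- The hash bit with the standard parameters (field level `level k m`). [cite: WegmanCarter1981, §3] -/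
def stdHashBitStr (k m : ℕ) (keyL u : List Bool) : Bool := hashBitStr (level k m) k keyL u

open scoped Classical in
/-- **The standard hash bit is membership in the standard family.** [cite: WegmanCarter1981, §3] -/
theorem stdHashBitStr_ofFn (k m : ℕ) (key : Fin (keyPoly.eval (k + m)) → Bool) (u : List Bool) :
    stdHashBitStr k m (List.ofFn key) u = decide (u ∈ stdFamily k m key) :=
  hashBitStr_ofFn (level k m) k (keyPoly.eval (k + m)) (mul_dim_level_le k m) key u

/-! ### Deciding the keyed language -/

/-- `keyPoly` is injective. [folklore] -/
private theorem keyPoly_eval_inj {a b : ℕ} (h : keyPoly.eval a = keyPoly.eval b) : a = b := by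
  simp only [keyPoly_eval] at h
  have h' : (a + 1) ^ 2 = (b + 1) ^ 2 := by omega
  have := Nat.pow_left_injective (n := 2) (by norm_num) h'
  simpa using this

/-- `m ≤ keyPoly (k + m)`. [folklore] -/
private theorem le_keyPoly_eval (k m : ℕ) : m ≤ keyPoly.eval (k + m) := by
  rw [keyPoly_eval]
  calc m ≤ k + m + 1 := by omega
    _ ≤ (k + m + 1) ^ 2 := Nat.le_self_pow two_ne_zero _
    _ ≤ 6 * (k + m + 1) ^ 2 := Nat.le_mul_of_pos_left _ (by norm_num)

/-- **The decision function of the keyed language**: decode `w = ⟨⟨1ᵏ, key⟩, u⟩` (re-encode and compare to reject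
malformed strings; `1ᵏ` must be all ones), and accept iff some `m ≤ |key|` has `|key| = 6(k+m+1)²` and the standard
hash bit for `(k, m)` is set (at most one `m` qualifies). [cite: WegmanCarter1981, §3] -/
def hashLangDecide (w : List Bool) : Bool :=
  let a := (boolUnpair w).1
  let u := (boolUnpair w).2
  let ks := (boolUnpair a).1
  let keyL := (boolUnpair a).2
  decide (w = boolPair (boolPair ks keyL) u) && decide (ks = List.replicate ks.length true) &&
    (List.range (keyL.length + 1)).any fun m =>
      decide (keyPoly.eval (ks.length + m) = keyL.length) && stdHashBitStr ks.length m keyL u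

/-- A list is `ofFn` of its own entries, at a prescribed length. [folklore] -/
private theorem ofFn_getElem_cast (l : List Bool) {n : ℕ} (hn : l.length = n) :
    List.ofFn (fun i : Fin n => l[(i : ℕ)]'(hn ▸ i.2)) = l := by
  subst hn
  exact List.ofFn_getElem

open scoped Classical in
/-- **`hashLangDecide` decides `hashLang`.** [cite: WegmanCarter1981, §3] -/
theorem hashLangDecide_eq (w : List Bool) : hashLangDecide w = decide (w ∈ hashLang) := by
  rw [Bool.eq_iff_iff, decide_eq_true_iff]
  constructor
  · intro h
    simp only [hashLangDecide, Bool.and_eq_true, decide_eq_true_eq, List.any_eq_true, List.mem_range] at h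
    obtain ⟨⟨hw, hks⟩, m, -, hlen, hbit⟩ := h
    set a := (boolUnpair w).1
    set u := (boolUnpair w).2
    set ks := (boolUnpair a).1
    set keyL := (boolUnpair a).2
    set k := ks.length
    set key : Fin (keyPoly.eval (k + m)) → Bool := fun i => keyL[(i : ℕ)]'(i.2.trans_eq hlen) with hkey
    have hkeyL : List.ofFn key = keyL := ofFn_getElem_cast keyL hlen.symm
    rw [← hkeyL, stdHashBitStr_ofFn, decide_eq_true_eq] at hbit
    rw [hw, hks, ← hkeyL]
    exact (mem_hashLang_iff k m key u).2 hbit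
  · rintro ⟨k, m, key, u, rfl, hu⟩
    simp only [hashLangDecide, boolUnpair_boolPair, List.length_replicate, List.length_ofFn, Bool.and_eq_true,
      decide_eq_true_eq, List.any_eq_true, List.mem_range, true_and]
    exact ⟨m, Nat.lt_succ_of_le (le_keyPoly_eval k m), rfl, by rw [stdHashBitStr_ofFn, decide_eq_true hu]⟩

end Literature.Computability.Cryptography.ExplicitKWiseHash

end
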